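import Mathlib
import HarnessLib
import Summits.CriticalPhenomena.CardyFormulaZ2.Theses.CardySelfDualSegment
import Literature.Probability.Percolation.CornerPercolation
import Literature.Barriers.CriticalPhenomena.EmbeddingModulusUniquenessProofs
import Literature.Probability.RandomPlanarGeometry.ConformalRectangleProofs
import Literature.Probability.RandomPlanarGeometry.CardyFunction
import Summits.CriticalPhenomena.CardyFormulaZ2.Theorems.CardySelfDualSegmentSegmentOpenStubCrossingProbPolynomial
import Summits.CriticalPhenomena.CardyFormulaZ2.Theorems.CardySelfDualSegmentSegmentOpenStubShearCrossRatioAnalytic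
import Summits.CriticalPhenomena.CardyFormulaZ2.Theorems.CardySelfDualSegmentSegmentOpenStubVitaliJets
import Summits.CriticalPhenomena.CardyFormulaZ2.Theorems.CardySelfDualSegmentSegmentOpenStubGoodSetNhdsZeroOfJets

/-!
# Crux `SegmentOpen` (stmt-CriticalPhenomena-5471), line `Sketch` — stub `stub_goodSet_univ_of_globalJets` (GJ)

Lead c5's glue stub of reshape 7 (GLOBAL JETS).  Statement (registered verbatim):

  S4w (local uniform-in-mesh complex bound of the crossing polynomials, radius depending on the
  centre `t₀ ∈ [0,1]` AND on the rectangle) → JC (convergence of every coefficient of the crossing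
  polynomials as `δ → 0⁺`) → JI (one real-analytic modulus curve `α` on `[0,1]` along which the
  perturbation series of the coefficient limits sums, near `0⁺`, to the sheared Cardy value) →
  every `t ∈ [0,1]` is a good point of route `CardySelfDualSegment`, with modulus `α t`.

All three hypotheses are the registered research stubs of `Cruxes/SegmentOpen/Lines/Sketch.lean`,
taken verbatim as hypotheses (nothing is claimed about them here); S1
(`stub_crossingProbPolynomial`, p97364), S7 (`stub_shearCrossRatioAnalytic`, p130521) and VJ
(`stub_vitaliJets`, p132875) are used as landed theorems.

Proof.  Fix `t` and sheared data `(R, R', φ, x)` at modulus `α t`; S7 gives the modulus function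
`M` of `R'` with `crossRatio x = M (α t)`; JC gives coefficient limits `a k`; JI gives
`Σ a k s^k = F(M(α s))` for `0 ≤ s < ε`.  It suffices to treat sequences of meshes `d n → 0⁺`.
For the fixed `R'`, compactness of `[0,1]` extracts from S4w finitely many discs `B(tᵢ, rᵢ)`
covering the segment, with a common mesh threshold and a common bound: their union `U` is open,
preconnected (each disc meets the connected segment) and contains `[0,1]`.  The complex crossing
polynomials `F n = p_{d n}` (`0` for the finitely many inadmissible `n`) are entire, uniformly
bounded on `U`, with `iteratedDeriv k (F n) 0 = k! · coeff_k → k! · a k`; VJ gives a holomorphic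
`g` on `U` with `F n → g` locally uniformly and `iteratedDeriv k g 0 = k! · a k`.  Taylor's theorem
on a small disc `B(0, ρ) ⊆ U` gives `g s = Σ a k s^k = F(M(α s))` for `0 ≤ s < min ε ρ`; both
`s ↦ re (g s)` and `s ↦ F(M(α s))` are real-analytic on `[0,1]` (the latter because `α` is, `M` is
real-analytic on `ℍ ∋ α s`, and `F` is analytic on `(0,1) ∋ M(α s)`), so the identity theorem on the
preconnected `[0,1]` gives `re (g t) = F(M(α t))`; finally `P_t(R', d n) = re (F n t) → re (g t)`.
-/

noncomputable section

namespace Summit.CriticalPhenomena.CardyFormulaZ2.Theorems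

open Literature.Probability Literature.Barriers.CriticalPhenomena
open Literature.Probability.RandomPlanarGeometry (ConformalRectangle ConformalEquiv MarkedDomain)
open Filter Set Topology MeasureTheory
open UpperHalfPlane (upperHalfPlaneSet)

namespace GoodSetUnivOfGlobalJets

open Literature.Probability.RandomPlanarGeometry

/-- Every conformal rectangle `R'` has a presentation of its shear `φ_β R'` (`β ∉ ℝ`) with a
uniformizing datum: `R'.map (shearHomeomorph β)` and `MarkedDomain.exists_isUniformizing_holds`. -/
theorem exists_shear_presentation (R' : ConformalRectangle) {β : ℂ} (hβ : β.im ≠ 0) :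
    ∃ (R : ConformalRectangle) (φ : ConformalEquiv UpperHalfPlane.upperHalfPlaneSet R.carrier)
      (x : Fin 4 → ℝ), R.carrier = moduliShear β '' R'.carrier ∧
      (∀ i, R.pt i = moduliShear β (R'.pt i)) ∧ R.IsUniformizing φ x := by
  -- adapted from Theorems/CardySelfDualSegmentSegmentOpenStubAccumulationInteriorGood.lean
  obtain ⟨φ, x, hφ⟩ :=
    MarkedDomain.exists_isUniformizing_holds (R'.map (shearHomeomorph β hβ))
  exact ⟨_, φ, x, by rw [MarkedDomain.carrier_map, coe_shearHomeomorph],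
    fun i => by rw [MarkedDomain.pt_map, coe_shearHomeomorph], hφ⟩

/-- The inclusion `unitInterval → ℂ` is continuous. -/
theorem continuous_coeC : Continuous fun s : unitInterval => ((s : ℝ) : ℂ) :=
  Complex.continuous_ofReal.comp continuous_subtype_val

/-- The segment `[0,1] ⊆ ℂ` (the range of `unitInterval → ℂ`) is preconnected (continuous image
of the preconnected `unitInterval`). -/
theorem isPreconnected_seg : IsPreconnected (range fun s : unitInterval => ((s : ℝ) : ℂ)) := by
  haveI : PreconnectedSpace unitInterval := Subtype.preconnectedSpace isPreconnected_Icc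
  exact isPreconnected_range continuous_coeC

/-- **Convergence along one sequence of meshes (global form).**  The analytic core of GJ: given
pointwise-in-`t₀` uniform bounds for the complex crossing polynomials `P δ` near every point of the
segment, convergence of their coefficients `coeff_k (P δ) → a k` as `δ → 0⁺`, a real-analytic `h`
on `[0,1]` with `Σ a k s^k = h s` for small `s ≥ 0`, the real evaluations `(P (d n)).eval t`
converge to `h t` at every `t ∈ [0,1]` along every sequence of meshes `d n → 0⁺`. -/
theorem tendsto_eval_of_globalJets {P : ℝ → Polynomial ℝ}
    (hB : ∀ t₀ : unitInterval, ∃ r > 0, ∃ δ₁ > 0, ∃ C : ℝ, ∀ δ : ℝ, 0 < δ → δ < δ₁ →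
      ∀ z ∈ Metric.ball ((t₀ : ℝ) : ℂ) r, ‖((P δ).map (algebraMap ℝ ℂ)).eval z‖ ≤ C)
    {a : ℕ → ℝ}
    (ha : ∀ k : ℕ, ∀ ε > 0, ∃ δ₀ > 0, ∀ δ : ℝ, 0 < δ → δ < δ₀ → |(P δ).coeff k - a k| < ε)
    {h : ℝ → ℝ} (hh : AnalyticOnNhd ℝ h (Icc 0 1))
    {ε : ℝ} (hε : 0 < ε) (hsum : ∀ s : ℝ, 0 ≤ s → s < ε → HasSum (fun k : ℕ => a k * s ^ k) (h s))
    {d : ℕ → ℝ} (hd : Tendsto d atTop (𝓝[>] 0)) (t : unitInterval) :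
    Tendsto (fun n => (P (d n)).eval (t : ℝ)) atTop (𝓝 (h t)) := by
  classical
  -- data of the pointwise bounds, indexed by the centres
  choose r hr δ₁ hδ₁ C hC using hB
  -- finite subcover of the compact parameter space
  set V : unitInterval → Set unitInterval := fun i =>
    {s : unitInterval | ((s : ℝ) : ℂ) ∈ Metric.ball ((i : ℝ) : ℂ) (r i)} with hV
  have hVo : ∀ i, IsOpen (V i) := fun i => Metric.isOpen_ball.preimage continuous_coeC
  have hVcov : (univ : Set unitInterval) ⊆ ⋃ i, V i := fun s _ =>
    mem_iUnion.2 ⟨s, Metric.mem_ball_self (hr s)⟩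
  obtain ⟨T, hT⟩ := isCompact_univ.elim_finite_subcover V hVo hVcov
  have hTne : T.Nonempty := by
    obtain ⟨i, hi, -⟩ := mem_iUnion₂.1 (hT (mem_univ 0))
    exact ⟨i, hi⟩
  -- common mesh threshold and common bound
  set δm : ℝ := T.inf' hTne δ₁ with hδm
  have hδm0 : 0 < δm := (Finset.lt_inf'_iff hTne).2 fun i _ => hδ₁ i
  have hδmle : ∀ i ∈ T, δm ≤ δ₁ i := fun i hi => Finset.inf'_le _ hi
  set Cm : ℝ := T.sup' hTne C with hCm
  have hCmle : ∀ i ∈ T, C i ≤ Cm := fun i hi => Finset.le_sup' _ hi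
  -- the complex neighbourhood of the segment
  set U : Set ℂ := ⋃ i ∈ T, Metric.ball (((i : unitInterval) : ℝ) : ℂ) (r i) with hU
  have hUo : IsOpen U := isOpen_biUnion fun i _ => Metric.isOpen_ball
  set seg : Set ℂ := range fun s : unitInterval => ((s : ℝ) : ℂ) with hseg
  have hsegU : seg ⊆ U := by
    rintro _ ⟨s, rfl⟩
    obtain ⟨i, hi, hs⟩ := mem_iUnion₂.1 (hT (mem_univ s))
    exact mem_iUnion₂.2 ⟨i, hi, hs⟩
  have hmemU : ∀ s : unitInterval, ((s : ℝ) : ℂ) ∈ U := fun s => hsegU ⟨s, rfl⟩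
  have h0U : (0 : ℂ) ∈ U := by simpa using hmemU 0
  have hUc : IsPreconnected U := by
    have hU' : U = ⋃ i ∈ T, (Metric.ball (((i : unitInterval) : ℝ) : ℂ) (r i) ∪ seg) := by
      apply Subset.antisymm
      · exact iUnion₂_mono fun i _ => subset_union_left
      · refine iUnion₂_subset fun i hi => union_subset ?_ hsegU
        exact subset_iUnion₂ (s := fun i _ => Metric.ball (((i : unitInterval) : ℝ) : ℂ) (r i)) i hi
    rw [hU', ← Finset.set_biUnion_coe, ← sUnion_image]
    refine isPreconnected_sUnion ((((0 : unitInterval) : ℝ) : ℂ)) _ ?_ ?_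
    · rintro _ ⟨i, -, rfl⟩
      exact Or.inr ⟨0, rfl⟩
    · rintro _ ⟨i, -, rfl⟩
      exact IsPreconnected.union (((i : unitInterval) : ℝ) : ℂ) (Metric.mem_ball_self (hr i))
        ⟨i, rfl⟩ (convex_ball _ _).isPreconnected isPreconnected_seg
  -- admissible meshes, eventually all of them
  have hgood : ∀ᶠ n in atTop, 0 < d n ∧ d n < δm := by
    have h1 : ∀ᶠ n in atTop, d n ∈ Ioo 0 δm := hd (Ioo_mem_nhdsGT hδm0)
    exact h1.mono fun n hn => hn
  -- the holomorphic sequence on `U`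
  set F : ℕ → ℂ → ℂ := fun n =>
    if 0 < d n ∧ d n < δm then fun z => ((P (d n)).map (algebraMap ℝ ℂ)).eval z else 0 with hF
  have hFgood : ∀ n, 0 < d n ∧ d n < δm →
      F n = fun z => ((P (d n)).map (algebraMap ℝ ℂ)).eval z := fun n hn => by
    simp only [hF, if_pos hn]
  have hFbad : ∀ n, ¬ (0 < d n ∧ d n < δm) → F n = 0 := fun n hn => by
    simp only [hF, if_neg hn]
  have hFd : ∀ n, DifferentiableOn ℂ (F n) U := fun n => by
    by_cases hn : 0 < d n ∧ d n < δm
    · rw [hFgood n hn]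
      exact (Polynomial.differentiable _).differentiableOn
    · rw [hFbad n hn]
      exact differentiableOn_const 0
  have hFb : ∀ w ∈ U, ∃ M : ℝ, ∃ ρ > 0, ∀ n, ∀ z ∈ Metric.ball w ρ ∩ U, ‖F n z‖ ≤ M := by
    intro w _
    refine ⟨max Cm 0, 1, one_pos, fun n z hz => ?_⟩
    by_cases hn : 0 < d n ∧ d n < δm
    · rw [hFgood n hn]
      obtain ⟨j, hj, hzj⟩ := mem_iUnion₂.1 hz.2
      exact ((hC j (d n) hn.1 (hn.2.trans_le (hδmle j hj)) z hzj).trans (hCmle j hj)).trans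
        (le_max_left _ _)
    · rw [hFbad n hn]
      simp
  -- the jets at `0` converge to `k! · a k`
  have hcoeff : ∀ k : ℕ, Tendsto (fun n => (P (d n)).coeff k) atTop (𝓝 (a k)) := by
    intro k
    rw [Metric.tendsto_nhds]
    intro e he
    obtain ⟨δ₀, hδ₀, hδ⟩ := ha k e he
    have h1 : ∀ᶠ n in atTop, d n ∈ Ioo 0 δ₀ := hd (Ioo_mem_nhdsGT hδ₀)
    exact h1.mono fun n hn => hδ (d n) hn.1 hn.2
  have hjet : ∀ k : ℕ, Tendsto (fun n => iteratedDeriv k (F n) 0) atTop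
      (𝓝 ((k.factorial : ℂ) * ((a k : ℝ) : ℂ))) := by
    intro k
    have h1 : Tendsto (fun n => (k.factorial : ℂ) * (((P (d n)).coeff k : ℝ) : ℂ)) atTop
        (𝓝 ((k.factorial : ℂ) * ((a k : ℝ) : ℂ))) :=
      ((Complex.continuous_ofReal.tendsto (a k)).comp (hcoeff k)).const_mul _
    refine h1.congr' ?_
    filter_upwards [hgood] with n hn
    rw [hFgood n hn, GoodSetNhdsZeroOfJets.iteratedDeriv_map_eval_zero]
  -- Vitali with jets on `U`
  obtain ⟨g, hgd, hgF, hgjet⟩ := stub_vitaliJets U hUo hUc 0 h0U F _ hFd hFb hjet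
  -- Taylor expansion of the limit at `0` on a small disc inside `U`
  obtain ⟨ρ, hρ, hball⟩ := Metric.isOpen_iff.1 hUo 0 h0U
  set u : ℝ → ℝ := fun s => (g ((s : ℝ) : ℂ)).re with hu_def
  have hnear : ∀ s : ℝ, 0 ≤ s → s < min ε ρ → u s = h s := by
    intro s hs0 hs
    simp only [hu_def]
    have hsε : s < ε := hs.trans_le (min_le_left _ _)
    have hsρ : s < ρ := hs.trans_le (min_le_right _ _)
    have hsB : (s : ℂ) ∈ Metric.ball (0 : ℂ) ρ := by
      rw [Metric.mem_ball, dist_zero_right, Complex.norm_real, Real.norm_eq_abs, abs_of_nonneg hs0]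
      exact hsρ
    have hT := Complex.hasSum_taylorSeries_on_ball (hgd.mono hball) hsB
    have hfun : (fun n : ℕ => (n.factorial : ℂ)⁻¹ • ((s : ℂ) - 0) ^ n • iteratedDeriv n g 0) =
        fun k : ℕ => (((a k * s ^ k : ℝ)) : ℂ) := by
      funext k
      rw [hgjet k, sub_zero, smul_eq_mul, smul_eq_mul]
      have hk : (k.factorial : ℂ) ≠ 0 := by exact_mod_cast Nat.factorial_ne_zero k
      push_cast
      field_simp
    rw [hfun] at hT
    have hLc : HasSum (fun k : ℕ => (((a k * s ^ k : ℝ)) : ℂ)) ((h s : ℝ) : ℂ) :=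
      (Complex.hasSum_ofReal (L := SummationFilter.unconditional ℕ)).2 (hsum s hs0 hsε)
    rw [hT.unique hLc, Complex.ofReal_re]
  -- both sides are real-analytic on `[0,1]`
  have hu : AnalyticOnNhd ℝ u (Icc 0 1) := by
    intro s hs
    rw [hu_def]
    have hsU : ((s : ℝ) : ℂ) ∈ U := hmemU ⟨s, hs⟩
    have hga : AnalyticAt ℂ g (s : ℂ) := (hgd.analyticOnNhd hUo) _ hsU
    have h1 : AnalyticAt ℝ (fun s : ℝ => g (s : ℂ)) s :=
      (hga.restrictScalars (𝕜 := ℝ)).comp_of_eq (Complex.ofRealCLM.analyticAt s) rfl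
    exact (Complex.reCLM.analyticAt _).comp h1
  -- the identity theorem on the segment
  have hfreq : ∃ᶠ s in 𝓝[≠] (0 : ℝ), u s = h s := by
    have hev : ∀ᶠ s in 𝓝[>] (0 : ℝ), u s = h s := by
      filter_upwards [Ioo_mem_nhdsGT (lt_min hε hρ)] with s hs using hnear s hs.1.le hs.2
    exact hev.frequently.filter_mono (nhdsWithin_mono _ fun x hx => ne_of_gt hx)
  have hEq : EqOn u h (Icc 0 1) :=
    hu.eqOn_of_preconnected_of_frequently_eq hh isPreconnected_Icc
      (left_mem_Icc.2 zero_le_one) hfreq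
  -- pointwise convergence at `t`
  have hpt : Tendsto (fun n => F n (t : ℂ)) atTop (𝓝 (g (t : ℂ))) := hgF.tendsto_at (hmemU t)
  have hre := (Complex.continuous_re.tendsto _).comp hpt
  have hut : (g ((t : ℝ) : ℂ)).re = h t := by
    have := hEq t.2
    simpa only [hu_def] using this
  rw [hut] at hre
  refine hre.congr' ?_
  filter_upwards [hgood] with n hn
  simp only [Function.comp_apply]
  rw [hFgood n hn]
  change (((P (d n)).map (algebraMap ℝ ℂ)).eval (algebraMap ℝ ℂ (t : ℝ))).re = _
  rw [Polynomial.eval_map, Polynomial.eval₂_at_apply]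
  rfl

end GoodSetUnivOfGlobalJets

open GoodSetUnivOfGlobalJets in
/-- **GJ — global jets ⇒ every point of the segment is good.**  From S4w (pointwise uniform-in-mesh
complex bounds of the crossing polynomials), JC (convergence of every coefficient as `δ → 0⁺`)
and JI (one real-analytic modulus curve `α` on `[0,1]`, `0 < im α`, along which the perturbation
series sums near `0⁺` to the sheared Cardy value `F(M(α s))`), all hypotheses verbatim the
registered stubs of line `Sketch`, EVERY `t ∈ [0,1]` is a good point of route
`CardySelfDualSegment`, with modulus `α t`: for sheared data `(R, R', φ, x)` at `α t`, S7 gives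
`crossRatio x = M (α t)`, and along every sequence of meshes `d n → 0⁺` the crossing probabilities
`P_t(R', d n)` converge to `F(M(α t))` (`tendsto_eval_of_globalJets`: Vitali with jets on a
connected complex neighbourhood of the segment + the identity theorem on `[0,1]`). -/
theorem stub_goodSet_univ_of_globalJets :
    (∀ (t₀ : unitInterval) (R : ConformalRectangle), ∃ r > 0, ∃ δ₁ > 0, ∃ C : ℝ, ∀ δ : ℝ,
      0 < δ → δ < δ₁ → ∀ p : Polynomial ℝ,
        (∀ t : unitInterval, Percolation.cornerCrossingProb t R δ = p.eval (t : ℝ)) →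
        ∀ z ∈ Metric.ball ((t₀ : ℝ) : ℂ) r, ‖(p.map (algebraMap ℝ ℂ)).eval z‖ ≤ C) →
    (∀ (R' : ConformalRectangle) (k : ℕ), ∃ a : ℝ, ∀ ε > 0, ∃ δ₀ > 0, ∀ δ : ℝ, 0 < δ → δ < δ₀ →
      ∀ p : Polynomial ℝ,
        (∀ t : unitInterval, Percolation.cornerCrossingProb t R' δ = p.eval (t : ℝ)) →
        |p.coeff k - a| < ε) →
    (∃ α : ℝ → ℂ, AnalyticOnNhd ℝ α (Set.Icc 0 1) ∧ (∀ s ∈ Set.Icc (0 : ℝ) 1, 0 < (α s).im) ∧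
      ∀ (R' : ConformalRectangle) (M : ℂ → ℝ), AnalyticOnNhd ℝ M {β : ℂ | 0 < β.im} →
        (∀ β : ℂ, 0 < β.im → ∀ (R : ConformalRectangle)
            (φ : ConformalEquiv UpperHalfPlane.upperHalfPlaneSet R.carrier) (x : Fin 4 → ℝ),
            R.carrier = moduliShear β '' R'.carrier → (∀ i, R.pt i = moduliShear β (R'.pt i)) →
            R.IsUniformizing φ x → RandomPlanarGeometry.crossRatio x = M β) →
        ∀ a : ℕ → ℝ,
          (∀ k : ℕ, ∀ ε > 0, ∃ δ₀ > 0, ∀ δ : ℝ, 0 < δ → δ < δ₀ → ∀ p : Polynomial ℝ,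
              (∀ t : unitInterval, Percolation.cornerCrossingProb t R' δ = p.eval (t : ℝ)) →
              |p.coeff k - a k| < ε) →
          ∃ ε > 0, ∀ s : ℝ, 0 ≤ s → s < ε →
            HasSum (fun k : ℕ => a k * s ^ k) (RandomPlanarGeometry.cardyFunction (M (α s)))) →
    ∀ t : unitInterval,
      t ∈ {t : unitInterval | ∃ α : ℂ, 0 < α.im ∧
        ∀ (R R' : ConformalRectangle)
          (φ : ConformalEquiv UpperHalfPlane.upperHalfPlaneSet R.carrier) (x : Fin 4 → ℝ),
          R.carrier = moduliShear α '' R'.carrier → (∀ i, R.pt i = moduliShear α (R'.pt i)) →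
          R.IsUniformizing φ x →
          Tendsto (Percolation.cornerCrossingProb t R') (𝓝[>] 0)
            (𝓝 (RandomPlanarGeometry.cardyFunction (RandomPlanarGeometry.crossRatio x)))} := by
  classical
  intro h4 hJC hJI t
  obtain ⟨α, hαan, hαim, hJ⟩ := hJI
  have ht01 : (t : ℝ) ∈ Icc (0 : ℝ) 1 := t.2
  refine ⟨α t, hαim _ ht01, ?_⟩
  intro R R' φ x hcar hpt hunif
  -- the modulus function of `R'` (S7)
  obtain ⟨M, hMan, hM⟩ := stub_shearCrossRatioAnalytic R'
  have hcr : RandomPlanarGeometry.crossRatio x = M (α t) :=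
    hM (α t) (hαim _ ht01) R φ x hcar hpt hunif
  have hM01 : ∀ β : ℂ, 0 < β.im → M β ∈ Ioo (0 : ℝ) 1 := fun β hβ => by
    obtain ⟨Q, ψ, y, hc, hp, hψ⟩ := exists_shear_presentation R' hβ.ne'
    rw [← hM β hβ Q ψ y hc hp hψ]
    exact ConformalRectangle.crossRatio_mem_Ioo_of_isUniformizing hψ
  -- crossing polynomials of `R'` (S1)
  set P : ℝ → Polynomial ℝ := fun δ =>
    if hδ : 0 < δ then Classical.choose (stub_crossingProbPolynomial R' δ hδ) else 0 with hP
  have hPspec : ∀ δ : ℝ, 0 < δ → ∀ s : unitInterval,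
      Percolation.cornerCrossingProb s R' δ = (P δ).eval (s : ℝ) := fun δ hδ => by
    simp only [hP, dif_pos hδ]
    exact Classical.choose_spec (stub_crossingProbPolynomial R' δ hδ)
  -- coefficient limits (JC) and their identification near `0⁺` (JI)
  choose a ha using hJC R'
  obtain ⟨ε, hε, hsum⟩ := hJ R' M hMan hM a ha
  -- the comparison function is real-analytic on `[0,1]`
  have hh : AnalyticOnNhd ℝ (fun s : ℝ => RandomPlanarGeometry.cardyFunction (M (α s)))
      (Icc 0 1) := by
    intro s hs
    have him := hαim s hs
    have h2 : AnalyticAt ℝ (fun s : ℝ => M (α s)) s := (hMan _ him).comp_of_eq (hαan s hs) rfl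
    exact (RandomPlanarGeometry.analyticOnNhd_cardyFunction_Ioo _ (hM01 _ him)).comp_of_eq h2 rfl
  rw [hcr]
  -- reduce to sequences of meshes
  rw [tendsto_iff_seq_tendsto]
  intro d hd
  have key := tendsto_eval_of_globalJets (P := P)
    (fun t₀ => by
      obtain ⟨r, hr, δ₁, hδ₁, C, hC⟩ := h4 t₀ R'
      exact ⟨r, hr, δ₁, hδ₁, C, fun δ hδ hδ' z hz => hC δ hδ hδ' (P δ) (hPspec δ hδ) z hz⟩)
    (fun k e he => by
      obtain ⟨δ₀, hδ₀, h⟩ := ha k e he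
      exact ⟨δ₀, hδ₀, fun δ hδ hδ' => h δ hδ hδ' (P δ) (hPspec δ hδ)⟩)
    hh hε hsum hd t
  -- `P_t(R', d n) = (P (d n)).eval t` for the admissible `n`
  have hgood : ∀ᶠ n in atTop, 0 < d n := by
    have h1 : ∀ᶠ n in atTop, d n ∈ Ioi 0 := hd self_mem_nhdsWithin
    exact h1.mono fun n hn => hn
  refine key.congr' ?_
  filter_upwards [hgood] with n hn
  exact (hPspec (d n) hn t).symm

end Summit.CriticalPhenomena.CardyFormulaZ2.Theorems
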